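import Summits.NavierStokesRegularity.NavierStokesRegularity.Theorems.ExtremiserTransienceTwoThirdsPiecePointwise
import Summits.NavierStokesRegularity.NavierStokesRegularity.Theorems.ExtremiserTransienceTwoThirdsPieceGauge
import HarnessLib

/-!
# Route `ExtremiserTransience`, crux `NearExtremalTransiencePerFlow` (stmt-NavierStokesRegularity-26567),
# LINE g10-1 «two_thirds» (ns-idea-10), stub S1a′ — BRICK 2, lemma P3c: POINTWISE BOUNDS FOR THE PIECE FIELD (abstract gauge)

`--supports stmt-NavierStokesRegularity-26567` (helper; prover seat ns-net-p2 g13).  The piece of `w` in a cell is `φ = curl(χ·ψ)` with a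
gauge `ψ` (`curl ψ = w − G`, `G` curl free on an open `T ⊇ tsupport χ`) and a thin-shell weight `χ` (`= 1` on `B(c,R)`, `= 0` near every
point with `‖x − c‖ ≥ R + ℓ`).  This file turns the identities of `…TwoThirdsPiecePointwise` (p729975) into BOUNDS in terms of abstract
sizes — `‖Dχ‖ ≤ k₁`, `‖D²χ‖ ≤ k₂`, `‖D³χ‖ ≤ k₃` (on the layer), `‖G‖ ≤ g₀`, `‖DG‖ ≤ g₁`, `‖ψ‖ ≤ p₀` on a set `S ⊇ tsupport χ`, `‖Dψ‖ ≤ p₁`,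
`‖w‖ ≤ 1`:

* `rankOneCurl_vanishing`, `fderiv_cutoff_eventuallyEq_zero` — `Dχ = 0` near every point off the layer `L = B(c,R+ℓ) ∖ B(c,R)`, so every
  rank-one curl `curlCLM(Dχ ⊗ F)` vanishes there to second order;
* `curl_piece_sub_eq_zero_off_layer`, `fderiv_curl_piece_sub_eq_zero_off_layer` — the enstrophy and palinstrophy offsets
  `curl φ − χ•ω`, `D(curl φ) − χ•Dω` VANISH off `L`;
* `norm_piece_le_of_sizes` — HEIGHT `‖φ‖ ≤ 1 + g₀ + c k₁ p₀` (`c = ‖curlCLM‖`);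
* `norm_fderiv_piece_sub_le_of_sizes` — `‖Dφ − χ•Dw‖ ≤ k₁ + g₁ + k₁g₀ + c(k₂p₀ + k₁p₁)`;
* `norm_curl_piece_sub_le_of_sizes` — `‖curl φ − χ•ω‖ ≤ c k₁ g₀ + c²k₂p₀ + c k₁‖w‖ + c²k₁‖Dψ‖` on `S`;
* `norm_fderiv_curl_piece_sub_le_of_sizes` — `‖D(curl φ) − χ•Dω‖ ≤ c(k₂g₀ + k₁g₁) + c²k₃p₀ + k₁‖ω‖ + ck₂‖w‖ + ck₁‖Dw‖ + 2c²k₂‖Dψ‖ + c²k₁‖D²ψ‖`.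
With the gauge sizes of `…TwoThirdsPieceGauge` (p730553: `g₀ ~ ρ⁻⁸`, `g₁ ~ ρ⁻¹⁶`, `p₀ ~ ρ`, `p₁ ~ ρ⁴`) and `kⱼ ~ ρ^{-7j}` every constant
term is `O(ρ⁻²)`.  HONEST FRAMING: calculus bookkeeping; nothing about Navier–Stokes is proved; no summit is proved by a line. [folklore]
-/

noncomputable section

open scoped Topology InnerProductSpace RealInnerProductSpace ENNReal NNReal ContDiff
open MeasureTheory Filter Set Metric
open Literature.Analysis.FluidPDE
open Summit.NavierStokesRegularity.NavierStokesRegularity.Theorems.DepletionLadder.KStar.HalfSpace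
open Summit.NavierStokesRegularity.NavierStokesRegularity.Theorems.NearExtremalTransiencePerFlow.LocalMaximiser

namespace Summit.NavierStokesRegularity.NavierStokesRegularity.Theorems.NearExtremalTransiencePerFlow.TwoThirds

-- the summit's namespace repeats the problem name by convention (D-0017)
set_option linter.dupNamespace false

section Vanishing

variable {χ : E3 → ℝ} {F : E3 → E3}

/-- Where `Dχ` vanishes near a point, the rank-one curl `curlCLM(Dχ ⊗ F)` vanishes near that point. [folklore] -/
theorem rankOneCurl_eventuallyEq_zero {x : E3} (h : fderiv ℝ χ =ᶠ[𝓝 x] fun _ => (0 : E3 →L[ℝ] ℝ)) :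
    (fun y => curlCLM ((fderiv ℝ χ y).smulRight (F y))) =ᶠ[𝓝 x] fun _ => (0 : E3) := by
  filter_upwards [h] with y hy
  rw [hy, ContinuousLinearMap.zero_smulRight, map_zero]

/-- … hence its value, its derivative, its curl and the derivative of its curl vanish at that point. [folklore] -/
theorem rankOneCurl_vanishing {x : E3} (h : fderiv ℝ χ =ᶠ[𝓝 x] fun _ => (0 : E3 →L[ℝ] ℝ)) :
    curlCLM ((fderiv ℝ χ x).smulRight (F x)) = 0 ∧
      fderiv ℝ (fun y => curlCLM ((fderiv ℝ χ y).smulRight (F y))) x = 0 ∧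
      curl (fun y => curlCLM ((fderiv ℝ χ y).smulRight (F y))) x = 0 ∧
      fderiv ℝ (curl fun y => curlCLM ((fderiv ℝ χ y).smulRight (F y))) x = 0 := by
  have hev := rankOneCurl_eventuallyEq_zero (F := F) h
  have h1 : fderiv ℝ (fun y => curlCLM ((fderiv ℝ χ y).smulRight (F y))) x = 0 := by
    rw [hev.fderiv_eq, fderiv_const_apply]
  have hev2 : ∀ᶠ y in 𝓝 x, (fun y => curlCLM ((fderiv ℝ χ y).smulRight (F y))) =ᶠ[𝓝 y] fun _ => (0 : E3) :=
    hev.eventually_nhds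
  have hcurl_ev : curl (fun y => curlCLM ((fderiv ℝ χ y).smulRight (F y))) =ᶠ[𝓝 x] fun _ => (0 : E3) := by
    filter_upwards [hev2] with y hy
    rw [curl_eq_curlCLM, hy.fderiv_eq, fderiv_const_apply, map_zero]
  refine ⟨?_, h1, hcurl_ev.eq_of_nhds, ?_⟩
  · have h0 : fderiv ℝ χ x = 0 := h.eq_of_nhds
    rw [h0, ContinuousLinearMap.zero_smulRight, map_zero]
  · rw [hcurl_ev.fderiv_eq, fderiv_const_apply]

/-- The thin-shell weight has `Dχ = 0` near every point off the layer `B(c, R+ℓ) ∖ B(c, R)`. [folklore] -/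
theorem fderiv_cutoff_eventuallyEq_zero {c : E3} {R ℓ : ℝ} (hone : ∀ x ∈ ball c R, χ x = 1)
    (hzero : ∀ x, R + ℓ ≤ ‖x - c‖ → χ =ᶠ[𝓝 x] fun _ => (0 : ℝ)) {x : E3} (hx : x ∉ ball c (R + ℓ) \ ball c R) :
    fderiv ℝ χ =ᶠ[𝓝 x] fun _ => (0 : E3 →L[ℝ] ℝ) := by
  rw [Set.mem_sdiff, not_and_or, not_not] at hx
  rcases hx with hx | hx
  · rw [mem_ball, dist_eq_norm, not_lt] at hx
    have hev : χ =ᶠ[𝓝 x] fun _ => (0 : ℝ) := hzero x hx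
    have hev2 : ∀ᶠ y in 𝓝 x, χ =ᶠ[𝓝 y] fun _ => (0 : ℝ) := hev.eventually_nhds
    filter_upwards [hev2] with y hy
    rw [hy.fderiv_eq, fderiv_const_apply]
  · have hev : χ =ᶠ[𝓝 x] fun _ => (1 : ℝ) := by
      filter_upwards [isOpen_ball.mem_nhds hx] with y hy
      exact hone y hy
    have hev2 : ∀ᶠ y in 𝓝 x, χ =ᶠ[𝓝 y] fun _ => (1 : ℝ) := hev.eventually_nhds
    filter_upwards [hev2] with y hy
    rw [hy.fderiv_eq, fderiv_const_apply]

end Vanishing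

section Sizes

variable {w ψ G : E3 → E3} {χ : E3 → ℝ} {c : E3} {R ℓ : ℝ} {T S : Set E3}

/-- **The enstrophy offset vanishes off the layer.** [folklore] -/
theorem curl_piece_sub_eq_zero_off_layer (hw : ContDiff ℝ (⊤ : ℕ∞) w) (hψ : ContDiff ℝ (⊤ : ℕ∞) ψ) (hG : ContDiff ℝ (⊤ : ℕ∞) G)
    (hχ : ContDiff ℝ (⊤ : ℕ∞) χ) (hcurl : ∀ x, curl ψ x = w x - G x)
    (hT : IsOpen T) (hχT : tsupport χ ⊆ T) (hG0 : ∀ x ∈ T, curl G x = 0)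
    (hone : ∀ x ∈ ball c R, χ x = 1) (hzero : ∀ x, R + ℓ ≤ ‖x - c‖ → χ =ᶠ[𝓝 x] fun _ => (0 : ℝ))
    {x : E3} (hx : x ∉ ball c (R + ℓ) \ ball c R) :
    curl (curl fun y => χ y • ψ y) x - χ x • curl w x = 0 := by
  have hD0 := fderiv_cutoff_eventuallyEq_zero hone hzero hx
  obtain ⟨hw0, -, -, -⟩ := rankOneCurl_vanishing (F := w) hD0
  obtain ⟨hG0v, -, -, -⟩ := rankOneCurl_vanishing (F := G) hD0
  obtain ⟨-, -, hψ0, -⟩ := rankOneCurl_vanishing (F := ψ) hD0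
  have hid := curl_piece_sub_eq hw hψ hG hχ hcurl hT hχT hG0 x
  rw [hw0, hG0v, hψ0, sub_zero, add_zero] at hid
  exact hid

/-- **The palinstrophy offset vanishes off the layer.** [folklore] -/
theorem fderiv_curl_piece_sub_eq_zero_off_layer (hw : ContDiff ℝ (⊤ : ℕ∞) w) (hψ : ContDiff ℝ (⊤ : ℕ∞) ψ)
    (hG : ContDiff ℝ (⊤ : ℕ∞) G) (hχ : ContDiff ℝ (⊤ : ℕ∞) χ) (hcurl : ∀ x, curl ψ x = w x - G x)
    (hT : IsOpen T) (hχT : tsupport χ ⊆ T) (hG0 : ∀ x ∈ T, curl G x = 0)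
    (hone : ∀ x ∈ ball c R, χ x = 1) (hzero : ∀ x, R + ℓ ≤ ‖x - c‖ → χ =ᶠ[𝓝 x] fun _ => (0 : ℝ))
    {x : E3} (hx : x ∉ ball c (R + ℓ) \ ball c R) :
    fderiv ℝ (curl (curl fun y => χ y • ψ y)) x - χ x • fderiv ℝ (curl w) x = 0 := by
  have hD0 := fderiv_cutoff_eventuallyEq_zero hone hzero hx
  obtain ⟨-, hw0, -, -⟩ := rankOneCurl_vanishing (F := w) hD0
  obtain ⟨-, hG0v, -, -⟩ := rankOneCurl_vanishing (F := G) hD0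
  obtain ⟨-, -, -, hψ0⟩ := rankOneCurl_vanishing (F := ψ) hD0
  have hDχ : fderiv ℝ χ x = 0 := hD0.eq_of_nhds
  have hid := fderiv_curl_piece_sub_eq hw hψ hG hχ hcurl hT hχT hG0 x
  rw [hw0, hG0v, hψ0, hDχ, ContinuousLinearMap.zero_smulRight, sub_zero, add_zero, zero_add] at hid
  exact hid

/-- **Height of the piece from sizes**: `‖φ‖ ≤ 1 + g₀ + c k₁ p₀`. [folklore] -/
theorem norm_piece_le_of_sizes (hψ : ContDiff ℝ (⊤ : ℕ∞) ψ) (hχ : ContDiff ℝ (⊤ : ℕ∞) χ) (hcurl : ∀ x, curl ψ x = w x - G x)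
    (hχS : tsupport χ ⊆ S) (hw1 : ∀ x, ‖w x‖ ≤ 1) (hχ1 : ∀ x, |χ x| ≤ 1)
    {k₁ g₀ p₀ : ℝ} (hk₁ : 0 ≤ k₁) (hg₀ : 0 ≤ g₀) (hp₀ : 0 ≤ p₀)
    (hD1 : ∀ x, ‖fderiv ℝ χ x‖ ≤ k₁) (hGle : ∀ x ∈ S, ‖G x‖ ≤ g₀) (hψle : ∀ x ∈ S, ‖ψ x‖ ≤ p₀) (x : E3) :
    ‖curl (fun y => χ y • ψ y) x‖ ≤ 1 + g₀ + ‖curlCLM‖ * k₁ * p₀ := by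
  have hcc0 : 0 ≤ ‖curlCLM‖ := norm_nonneg curlCLM
  by_cases hxS : x ∈ tsupport χ
  · have hx : x ∈ S := hχS hxS
    have h := norm_piece_le hχ hψ hcurl x
    have t1 : |χ x| * ‖w x‖ ≤ 1 := by
      calc |χ x| * ‖w x‖ ≤ 1 * 1 := mul_le_mul (hχ1 x) (hw1 x) (norm_nonneg _) zero_le_one
        _ = 1 := one_mul 1
    have t2 : |χ x| * ‖G x‖ ≤ g₀ := by
      calc |χ x| * ‖G x‖ ≤ 1 * g₀ := mul_le_mul (hχ1 x) (hGle x hx) (norm_nonneg _) zero_le_one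
        _ = g₀ := one_mul _
    have t3 : ‖curlCLM‖ * ‖fderiv ℝ χ x‖ * ‖ψ x‖ ≤ ‖curlCLM‖ * k₁ * p₀ :=
      mul_le_mul (mul_le_mul_of_nonneg_left (hD1 x) hcc0) (hψle x hx) (norm_nonneg _) (mul_nonneg hcc0 hk₁)
    linarith only [h, t1, t2, t3]
  · have h0 : curl (fun y => χ y • ψ y) x = 0 :=
      curl_eq_zero_of_notMem_tsupport fun h => hxS ((tsupport_smul_subset_left _ _) h)
    rw [h0, norm_zero]
    positivity

/-- **Gradient offset from sizes**: `‖Dφ − χ•Dw‖ ≤ k₁ + g₁ + k₁g₀ + c(k₂p₀ + k₁p₁)`. [folklore] -/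
theorem norm_fderiv_piece_sub_le_of_sizes (hw : ContDiff ℝ (⊤ : ℕ∞) w) (hψ : ContDiff ℝ (⊤ : ℕ∞) ψ) (hG : ContDiff ℝ (⊤ : ℕ∞) G)
    (hχ : ContDiff ℝ (⊤ : ℕ∞) χ) (hcurl : ∀ x, curl ψ x = w x - G x)
    (hχS : tsupport χ ⊆ S) (hw1 : ∀ x, ‖w x‖ ≤ 1) (hχ1 : ∀ x, |χ x| ≤ 1)
    {k₁ k₂ g₀ g₁ p₀ p₁ : ℝ} (hk₁ : 0 ≤ k₁) (hk₂ : 0 ≤ k₂) (hg₀ : 0 ≤ g₀) (hg₁ : 0 ≤ g₁) (hp₀ : 0 ≤ p₀) (hp₁ : 0 ≤ p₁)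
    (hD1 : ∀ x, ‖fderiv ℝ χ x‖ ≤ k₁) (hD2 : ∀ x, ‖iteratedFDeriv ℝ 2 χ x‖ ≤ k₂)
    (hGle : ∀ x ∈ S, ‖G x‖ ≤ g₀) (hDGle : ∀ x ∈ S, ‖fderiv ℝ G x‖ ≤ g₁)
    (hψle : ∀ x ∈ S, ‖ψ x‖ ≤ p₀) (hDψle : ∀ x, ‖fderiv ℝ ψ x‖ ≤ p₁) (x : E3) :
    ‖fderiv ℝ (curl fun y => χ y • ψ y) x - χ x • fderiv ℝ w x‖ ≤
      k₁ + g₁ + k₁ * g₀ + ‖curlCLM‖ * (k₂ * p₀ + k₁ * p₁) := by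
  have hcc0 : 0 ≤ ‖curlCLM‖ := norm_nonneg curlCLM
  by_cases hxS : x ∈ tsupport χ
  · have hx : x ∈ S := hχS hxS
    have h := norm_fderiv_piece_sub_le hw hψ hG hχ hcurl x
    have t1 : ‖fderiv ℝ χ x‖ * ‖w x‖ ≤ k₁ := by
      calc ‖fderiv ℝ χ x‖ * ‖w x‖ ≤ k₁ * 1 := mul_le_mul (hD1 x) (hw1 x) (norm_nonneg _) hk₁
        _ = k₁ := mul_one _
    have t2 : |χ x| * ‖fderiv ℝ G x‖ ≤ g₁ := by
      calc |χ x| * ‖fderiv ℝ G x‖ ≤ 1 * g₁ := mul_le_mul (hχ1 x) (hDGle x hx) (norm_nonneg _) zero_le_one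
        _ = g₁ := one_mul _
    have t3 : ‖fderiv ℝ χ x‖ * ‖G x‖ ≤ k₁ * g₀ := mul_le_mul (hD1 x) (hGle x hx) (norm_nonneg _) hk₁
    have t4 : ‖iteratedFDeriv ℝ 2 χ x‖ * ‖ψ x‖ ≤ k₂ * p₀ := mul_le_mul (hD2 x) (hψle x hx) (norm_nonneg _) hk₂
    have t5 : ‖fderiv ℝ χ x‖ * ‖fderiv ℝ ψ x‖ ≤ k₁ * p₁ := mul_le_mul (hD1 x) (hDψle x) (norm_nonneg _) hk₁
    have t45 : ‖curlCLM‖ * (‖iteratedFDeriv ℝ 2 χ x‖ * ‖ψ x‖ + ‖fderiv ℝ χ x‖ * ‖fderiv ℝ ψ x‖) ≤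
        ‖curlCLM‖ * (k₂ * p₀ + k₁ * p₁) := mul_le_mul_of_nonneg_left (add_le_add t4 t5) hcc0
    linarith only [h, t1, t2, t3, t45]
  · have hχ0 : χ =ᶠ[𝓝 x] 0 := notMem_tsupport_iff_eventuallyEq.1 hxS
    have hχ0' : ∀ᶠ y in 𝓝 x, χ =ᶠ[𝓝 y] 0 := hχ0.eventually_nhds
    have hev : (curl fun y => χ y • ψ y) =ᶠ[𝓝 x] fun _ => (0 : E3) := by
      filter_upwards [hχ0'] with y hy
      refine curl_eq_zero_of_notMem_tsupport fun h => ?_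
      exact (notMem_tsupport_iff_eventuallyEq.2 hy) ((tsupport_smul_subset_left _ _) h)
    have hχx : χ x = 0 := image_eq_zero_of_notMem_tsupport hxS
    have h1 : fderiv ℝ (curl fun y => χ y • ψ y) x = 0 := by rw [hev.fderiv_eq, fderiv_const_apply]
    have h2 : χ x • fderiv ℝ w x = 0 := by rw [hχx]; exact zero_smul ℝ (fderiv ℝ w x)
    rw [h1, h2, sub_zero, norm_zero]
    positivity

/-- **Enstrophy offset from sizes** (at a point of `S`): `‖curl φ − χ•ω‖ ≤ c k₁ g₀ + c²k₂p₀ + c k₁‖w‖ + c²k₁‖Dψ‖`. [folklore] -/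
theorem norm_curl_piece_sub_le_of_sizes (hw : ContDiff ℝ (⊤ : ℕ∞) w) (hψ : ContDiff ℝ (⊤ : ℕ∞) ψ) (hG : ContDiff ℝ (⊤ : ℕ∞) G)
    (hχ : ContDiff ℝ (⊤ : ℕ∞) χ) (hcurl : ∀ x, curl ψ x = w x - G x)
    (hT : IsOpen T) (hχT : tsupport χ ⊆ T) (hG0 : ∀ x ∈ T, curl G x = 0)
    {k₁ k₂ g₀ p₀ : ℝ} (hk₁ : 0 ≤ k₁) (hk₂ : 0 ≤ k₂)
    (hD1 : ∀ x, ‖fderiv ℝ χ x‖ ≤ k₁) (hD2 : ∀ x, ‖iteratedFDeriv ℝ 2 χ x‖ ≤ k₂)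
    (hGle : ∀ x ∈ S, ‖G x‖ ≤ g₀) (hψle : ∀ x ∈ S, ‖ψ x‖ ≤ p₀) {x : E3} (hx : x ∈ S) :
    ‖curl (curl fun y => χ y • ψ y) x - χ x • curl w x‖ ≤
      ‖curlCLM‖ * k₁ * g₀ + ‖curlCLM‖ * ‖curlCLM‖ * k₂ * p₀ + ‖curlCLM‖ * k₁ * ‖w x‖ +
        ‖curlCLM‖ * ‖curlCLM‖ * k₁ * ‖fderiv ℝ ψ x‖ := by
  have hcc0 : 0 ≤ ‖curlCLM‖ := norm_nonneg curlCLM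
  have h := norm_curl_piece_sub_le hw hψ hG hχ hcurl hT hχT hG0 x
  have t1 : ‖curlCLM‖ * ‖fderiv ℝ χ x‖ * ‖w x‖ ≤ ‖curlCLM‖ * k₁ * ‖w x‖ :=
    mul_le_mul_of_nonneg_right (mul_le_mul_of_nonneg_left (hD1 x) hcc0) (norm_nonneg (w x))
  have t2 : ‖curlCLM‖ * ‖fderiv ℝ χ x‖ * ‖G x‖ ≤ ‖curlCLM‖ * k₁ * g₀ :=
    mul_le_mul (mul_le_mul_of_nonneg_left (hD1 x) hcc0) (hGle x hx) (norm_nonneg (G x)) (mul_nonneg hcc0 hk₁)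
  have t3 : ‖iteratedFDeriv ℝ 2 χ x‖ * ‖ψ x‖ ≤ k₂ * p₀ := mul_le_mul (hD2 x) (hψle x hx) (norm_nonneg (ψ x)) hk₂
  have t4 : ‖fderiv ℝ χ x‖ * ‖fderiv ℝ ψ x‖ ≤ k₁ * ‖fderiv ℝ ψ x‖ :=
    mul_le_mul_of_nonneg_right (hD1 x) (norm_nonneg (fderiv ℝ ψ x))
  have t34 : ‖curlCLM‖ * (‖curlCLM‖ * (‖iteratedFDeriv ℝ 2 χ x‖ * ‖ψ x‖ + ‖fderiv ℝ χ x‖ * ‖fderiv ℝ ψ x‖)) ≤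
      ‖curlCLM‖ * (‖curlCLM‖ * (k₂ * p₀ + k₁ * ‖fderiv ℝ ψ x‖)) :=
    mul_le_mul_of_nonneg_left (mul_le_mul_of_nonneg_left (add_le_add t3 t4) hcc0) hcc0
  have e : ‖curlCLM‖ * (‖curlCLM‖ * (k₂ * p₀ + k₁ * ‖fderiv ℝ ψ x‖)) =
      ‖curlCLM‖ * ‖curlCLM‖ * k₂ * p₀ + ‖curlCLM‖ * ‖curlCLM‖ * k₁ * ‖fderiv ℝ ψ x‖ := by ring
  linarith only [h, t1, t2, t34, e]

/-- **Palinstrophy offset from sizes** (at a point of `S` where `‖D³χ‖ ≤ k₃`):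
`‖D(curl φ) − χ•Dω‖ ≤ c(k₂g₀ + k₁g₁) + c²k₃p₀ + k₁‖ω‖ + ck₂‖w‖ + ck₁‖Dw‖ + 2c²k₂‖Dψ‖ + c²k₁‖D²ψ‖`. [folklore] -/
theorem norm_fderiv_curl_piece_sub_le_of_sizes (hw : ContDiff ℝ (⊤ : ℕ∞) w) (hψ : ContDiff ℝ (⊤ : ℕ∞) ψ)
    (hG : ContDiff ℝ (⊤ : ℕ∞) G) (hχ : ContDiff ℝ (⊤ : ℕ∞) χ) (hcurl : ∀ x, curl ψ x = w x - G x)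
    (hT : IsOpen T) (hχT : tsupport χ ⊆ T) (hG0 : ∀ x ∈ T, curl G x = 0)
    {k₁ k₂ k₃ g₀ g₁ p₀ : ℝ} (hk₁ : 0 ≤ k₁) (hk₂ : 0 ≤ k₂) (hk₃ : 0 ≤ k₃)
    (hD1 : ∀ x, ‖fderiv ℝ χ x‖ ≤ k₁) (hD2 : ∀ x, ‖iteratedFDeriv ℝ 2 χ x‖ ≤ k₂)
    (hGle : ∀ x ∈ S, ‖G x‖ ≤ g₀) (hDGle : ∀ x ∈ S, ‖fderiv ℝ G x‖ ≤ g₁) (hψle : ∀ x ∈ S, ‖ψ x‖ ≤ p₀)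
    {x : E3} (hx : x ∈ S) (hD3 : ‖iteratedFDeriv ℝ 3 χ x‖ ≤ k₃) :
    ‖fderiv ℝ (curl (curl fun y => χ y • ψ y)) x - χ x • fderiv ℝ (curl w) x‖ ≤
      ‖curlCLM‖ * (k₂ * g₀ + k₁ * g₁) + ‖curlCLM‖ * ‖curlCLM‖ * k₃ * p₀ + k₁ * ‖curl w x‖ +
        ‖curlCLM‖ * k₂ * ‖w x‖ + ‖curlCLM‖ * k₁ * ‖fderiv ℝ w x‖ + 2 * ‖curlCLM‖ * ‖curlCLM‖ * k₂ * ‖fderiv ℝ ψ x‖ +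
        ‖curlCLM‖ * ‖curlCLM‖ * k₁ * ‖iteratedFDeriv ℝ 2 ψ x‖ := by
  have hcc0 : 0 ≤ ‖curlCLM‖ := norm_nonneg curlCLM
  have h := norm_fderiv_curl_piece_sub_le hw hψ hG hχ hcurl hT hχT hG0 x
  have t1 : ‖fderiv ℝ χ x‖ * ‖curl w x‖ ≤ k₁ * ‖curl w x‖ := mul_le_mul_of_nonneg_right (hD1 x) (norm_nonneg (curl w x))
  have t2 : ‖iteratedFDeriv ℝ 2 χ x‖ * ‖w x‖ ≤ k₂ * ‖w x‖ := mul_le_mul_of_nonneg_right (hD2 x) (norm_nonneg (w x))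
  have t3 : ‖fderiv ℝ χ x‖ * ‖fderiv ℝ w x‖ ≤ k₁ * ‖fderiv ℝ w x‖ :=
    mul_le_mul_of_nonneg_right (hD1 x) (norm_nonneg (fderiv ℝ w x))
  have t4 : ‖iteratedFDeriv ℝ 2 χ x‖ * ‖G x‖ ≤ k₂ * g₀ := mul_le_mul (hD2 x) (hGle x hx) (norm_nonneg (G x)) hk₂
  have t5 : ‖fderiv ℝ χ x‖ * ‖fderiv ℝ G x‖ ≤ k₁ * g₁ := mul_le_mul (hD1 x) (hDGle x hx) (norm_nonneg _) hk₁
  have t6 : ‖iteratedFDeriv ℝ 3 χ x‖ * ‖ψ x‖ ≤ k₃ * p₀ := mul_le_mul hD3 (hψle x hx) (norm_nonneg (ψ x)) hk₃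
  have t7 : 2 * ‖iteratedFDeriv ℝ 2 χ x‖ * ‖fderiv ℝ ψ x‖ ≤ 2 * k₂ * ‖fderiv ℝ ψ x‖ :=
    mul_le_mul_of_nonneg_right (mul_le_mul_of_nonneg_left (hD2 x) (by norm_num)) (norm_nonneg (fderiv ℝ ψ x))
  have t8 : ‖fderiv ℝ χ x‖ * ‖iteratedFDeriv ℝ 2 ψ x‖ ≤ k₁ * ‖iteratedFDeriv ℝ 2 ψ x‖ :=
    mul_le_mul_of_nonneg_right (hD1 x) (norm_nonneg (iteratedFDeriv ℝ 2 ψ x))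
  have t23 : ‖curlCLM‖ * (‖iteratedFDeriv ℝ 2 χ x‖ * ‖w x‖ + ‖fderiv ℝ χ x‖ * ‖fderiv ℝ w x‖) ≤
      ‖curlCLM‖ * (k₂ * ‖w x‖ + k₁ * ‖fderiv ℝ w x‖) := mul_le_mul_of_nonneg_left (add_le_add t2 t3) hcc0
  have t45 : ‖curlCLM‖ * (‖iteratedFDeriv ℝ 2 χ x‖ * ‖G x‖ + ‖fderiv ℝ χ x‖ * ‖fderiv ℝ G x‖) ≤
      ‖curlCLM‖ * (k₂ * g₀ + k₁ * g₁) := mul_le_mul_of_nonneg_left (add_le_add t4 t5) hcc0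
  have t678 : ‖curlCLM‖ * (‖curlCLM‖ * (‖iteratedFDeriv ℝ 3 χ x‖ * ‖ψ x‖ + 2 * ‖iteratedFDeriv ℝ 2 χ x‖ * ‖fderiv ℝ ψ x‖ +
        ‖fderiv ℝ χ x‖ * ‖iteratedFDeriv ℝ 2 ψ x‖)) ≤
      ‖curlCLM‖ * (‖curlCLM‖ * (k₃ * p₀ + 2 * k₂ * ‖fderiv ℝ ψ x‖ + k₁ * ‖iteratedFDeriv ℝ 2 ψ x‖)) :=
    mul_le_mul_of_nonneg_left (mul_le_mul_of_nonneg_left (add_le_add (add_le_add t6 t7) t8) hcc0) hcc0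
  have e1 : ‖curlCLM‖ * (k₂ * ‖w x‖ + k₁ * ‖fderiv ℝ w x‖) = ‖curlCLM‖ * k₂ * ‖w x‖ + ‖curlCLM‖ * k₁ * ‖fderiv ℝ w x‖ := by
    ring
  have e2 : ‖curlCLM‖ * (‖curlCLM‖ * (k₃ * p₀ + 2 * k₂ * ‖fderiv ℝ ψ x‖ + k₁ * ‖iteratedFDeriv ℝ 2 ψ x‖)) =
      ‖curlCLM‖ * ‖curlCLM‖ * k₃ * p₀ + 2 * ‖curlCLM‖ * ‖curlCLM‖ * k₂ * ‖fderiv ℝ ψ x‖ +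
        ‖curlCLM‖ * ‖curlCLM‖ * k₁ * ‖iteratedFDeriv ℝ 2 ψ x‖ := by ring
  linarith only [h, t1, t23, t45, t678, e1, e2]

end Sizes

end Summit.NavierStokesRegularity.NavierStokesRegularity.Theorems.NearExtremalTransiencePerFlow.TwoThirds

end
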